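import Summits.BirchSwinnertonDyer.BirchSwinnertonDyer.Theorems.GenusKolyvaginAtTwoEquivariantKolyvaginExactAtTwoEigenClassesFinite
import Summits.BirchSwinnertonDyer.BirchSwinnertonDyer.Theorems.CMKolyvaginAtInertTwoPairDataAtTwo
import HarnessLib

/-!
# Route `CMKolyvaginAtInertTwo`, crux `CMKolyvaginExactAtInertTwo` (stmt-BirchSwinnertonDyer-24277):
# THE `ℚ`-PAIR CARRIER MAPPED INTO THE EIGEN-PAIR: `f = (res, ψ ∘ res) : H¹(ℚ,E[2^M]) × H¹(ℚ,E^{(d)}[2^M]) → V⁺ × V⁻`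

Seat `bsd-line-cmk2-p1` g14 (cell `bsd-print-cf2`); helper (`--supports stmt-BirchSwinnertonDyer-24277`).
THEOREMS ONLY: no definition, no named fact, no `sorry`; no item is closed; BSD is not proved by this.

Path (β) of the T2 design (KERNEL-STATUS §13.9, MEMO-T2-assembly-kit §3): the carrier-free assembly
`card_mul_card_le_two_pow_two_mul_of_injective` (p690708) wants an injective additive
`f : V' → PairV W c M ε`. For the `ℚ`-pair carrier `V' = H¹(ℚ, E[2^M]) × H¹(ℚ, E^{(d)}[2^M])`
(`K = ℚ(θ)`, `θ² = d`, `c = σ₀` the non-trivial automorphism, sign `ε = 1`) this is the pair of the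
finite-level inflation–restriction isomorphisms of the `GenusKolyvaginAtTwo` lineage
(`…EquivariantKolyvaginExactAtTwoEigenClassesFinite`): `res : H¹(ℚ,E[n]) ≅ H¹(K,E[n])^{+}` and
`ψ ∘ res : H¹(ℚ,E^{(d)}[n]) ≅ H¹(K,E[n])^{−}` (`E(K)[n] = 0`). This file packages them as ONE
injective map into `PairV W σ₀ M 1` with its two coordinate formulas (existence form, no definition):
the collision group of p690708 is then `f⁻¹(pairDelta) = {(a, b) : res a + ψ(res b) = 0}` — the
`2`-torsion-tolerant replacement of the uninhabited `sel_visible` of `…VisiblePairAtTwoH2Vacuity`.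

* `exists_pairOfRat` — `∃ f`, injective, `(f(a,b)).1 = res a`, `(f(a,b)).2 = ψ (res b)`;
* `mem_preimage_pairDelta_iff` — `f (a,b) ∈ pairDelta ↔ res a + ψ (res b) = 0` for any such `f`.

References: [GrossLMS1991] §5 (5.1); [McCallumLMS1991] §5; [Kolyvagin1989Izv] §3;
[SerreGaloisCohomology1997] I §2.6 (b).
-/

-- single-conjunct summit: `Summit.BirchSwinnertonDyer.BirchSwinnertonDyer.…` repeats the name by design
set_option linter.dupNamespace false
set_option autoImplicit false

noncomputable section

open scoped Classical
open WeierstrassCurve NumberField Field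
open Literature.NumberTheory.GaloisRepresentations
open Literature.NumberTheory.EllipticCurves Literature.NumberTheory.EllipticCurves.KolyvaginDescent
open Summit.BirchSwinnertonDyer.BirchSwinnertonDyer.Theorems.GenusExact.EigenClassesFinite

namespace Summit.BirchSwinnertonDyer.BirchSwinnertonDyer.Theorems.KolyvaginPairDataTwo

variable (W : WeierstrassCurve ℚ) (K : Type) [Field K] [NumberField K]
  (h2 : Module.finrank ℚ K = 2) {θ : K} {d : ℚ} (hθ : θ ∉ Set.range (algebraMap ℚ K))
  (hd : θ ^ 2 = algebraMap ℚ K d) (M : ℕ)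

/-- **The `ℚ`-pair carrier mapped into the eigen-pair.** With `E(K)[2^M] = 0` there is an INJECTIVE
additive `f : H¹(ℚ, E[2^M]) × H¹(ℚ, E^{(d)}[2^M]) → V⁺ × V⁻ = PairV W σ₀ M 1` with
`(f(a,b)).1 = res a` and `(f(a,b)).2 = ψ (res b)`. [cite: GrossLMS1991, §5 (5.1)]
[cite: SerreGaloisCohomology1997, I §2.6 (b)] -/
theorem exists_pairOfRat
    (hL : ∀ P : (W.baseChange K).toAffine.Point, ((2 ^ M : ℕ) : ℤ) • P = 0 → P = 0) :
    ∃ f : galH1Torsion W ((2 ^ M : ℕ) : ℤ) × galH1Torsion (W.quadraticTwist d) ((2 ^ M : ℕ) : ℤ) →+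
        PairV W (sigmaQ K h2 hθ hd) M 1,
      Function.Injective f ∧
      (∀ v, ((f v).1 : galH1Torsion (W.baseChange K) ((2 ^ M : ℕ) : ℤ)) =
        resTorsion W K ((2 ^ M : ℕ) : ℤ) v.1) ∧
      (∀ v, ((f v).2 : galH1Torsion (W.baseChange K) ((2 ^ M : ℕ) : ℤ)) =
        hPsiKT W K hθ hd ((2 ^ M : ℕ) : ℤ) (resTorsion (W.quadraticTwist d) K ((2 ^ M : ℕ) : ℤ) v.2)) := by
  set n : ℤ := ((2 ^ M : ℕ) : ℤ) with hn
  -- the two coordinate maps, with values in the eigengroups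
  have h₁ : ∀ a : galH1Torsion W n, resTorsion W K n a ∈ eigK W (sigmaQ K h2 hθ hd) M 1 := by
    intro a
    rw [mem_eigK_iff, one_zsmul]
    exact (mem_range_resTorsion_iff_conjAct_eq W K h2 hθ hd n hL _).mp ⟨a, rfl⟩
  have h₂ : ∀ b : galH1Torsion (W.quadraticTwist d) n,
      hPsiKT W K hθ hd n (resTorsion (W.quadraticTwist d) K n b) ∈ eigK W (sigmaQ K h2 hθ hd) M (-1) := by
    intro b
    rw [mem_eigK_iff, neg_one_zsmul]
    exact (exists_hPsiKT_resTorsion_eq_iff_conjAct_eq_neg W K h2 hθ hd n hL _).mp ⟨b, rfl⟩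
  set f₁ : galH1Torsion W n →+ ↥(eigK W (sigmaQ K h2 hθ hd) M 1) :=
    (resTorsion W K n).codRestrict _ h₁ with hf₁
  set f₂ : galH1Torsion (W.quadraticTwist d) n →+ ↥(eigK W (sigmaQ K h2 hθ hd) M (-1)) :=
    ((hPsiKT W K hθ hd n).toAddMonoidHom.comp (resTorsion (W.quadraticTwist d) K n)).codRestrict _ h₂
    with hf₂
  refine ⟨AddMonoidHom.prodMap f₁ f₂, ?_, fun _ ↦ rfl, fun _ ↦ rfl⟩
  -- injectivity, componentwise
  have hi₁ : Function.Injective f₁ := fun a a' h ↦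
    resTorsion_injective_of_noTorsion W K h2 hθ hd n hL (congrArg Subtype.val h)
  have hi₂ : Function.Injective f₂ := fun b b' h ↦
    resTorsion_twist_injective_of_noTorsion W K h2 hθ hd n hL
      ((hPsiKT W K hθ hd n).injective (congrArg Subtype.val h))
  intro v w h
  have h1 := congrArg Prod.fst h
  have h2' := congrArg Prod.snd h
  exact Prod.ext (hi₁ h1) (hi₂ h2')

/-- **The collision group of the `ℚ`-pair carrier**: for any `f` as in `exists_pairOfRat`,
`f (a, b) ∈ pairDelta ↔ res a + ψ (res b) = 0` in `H¹(K, E[2^M])` — the `2`-torsion-tolerant form of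
the joint-injectivity condition `sel_visible`. [cite: Kolyvagin1989Izv, §3] [cite: GrossLMS1991, §5 (5.1)] -/
theorem mem_preimage_pairDelta_iff
    (f : galH1Torsion W ((2 ^ M : ℕ) : ℤ) × galH1Torsion (W.quadraticTwist d) ((2 ^ M : ℕ) : ℤ) →+
      PairV W (sigmaQ K h2 hθ hd) M 1)
    (hf₁ : ∀ v, ((f v).1 : galH1Torsion (W.baseChange K) ((2 ^ M : ℕ) : ℤ)) =
      resTorsion W K ((2 ^ M : ℕ) : ℤ) v.1)
    (hf₂ : ∀ v, ((f v).2 : galH1Torsion (W.baseChange K) ((2 ^ M : ℕ) : ℤ)) =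
      hPsiKT W K hθ hd ((2 ^ M : ℕ) : ℤ) (resTorsion (W.quadraticTwist d) K ((2 ^ M : ℕ) : ℤ) v.2))
    (v : galH1Torsion W ((2 ^ M : ℕ) : ℤ) × galH1Torsion (W.quadraticTwist d) ((2 ^ M : ℕ) : ℤ)) :
    f v ∈ pairDelta W (sigmaQ K h2 hθ hd) M 1 ↔
      resTorsion W K ((2 ^ M : ℕ) : ℤ) v.1 +
        hPsiKT W K hθ hd ((2 ^ M : ℕ) : ℤ) (resTorsion (W.quadraticTwist d) K ((2 ^ M : ℕ) : ℤ) v.2) = 0 := by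
  rw [mem_pairDelta_iff, hf₁, hf₂]

end Summit.BirchSwinnertonDyer.BirchSwinnertonDyer.Theorems.KolyvaginPairDataTwo

end
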